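import Mathlib
import HarnessLib
import Summits.Ventures.LatticeQCDFlow.Exactness.SphereDriftLift
import Summits.Ventures.LatticeQCDFlow.Exactness.MomentumRefresh

/-!
# HMC and THMC on the site sphere with the exact geodesic integrator of Engel–Schaefer are exact: `hmc_config_exact` instantiated

HONEST FRAMING: exact (Metropolis-corrected) sampling algorithms for lattice gauge theory;
figures of merit are autocorrelation/cost numbers at stated couplings and volumes; no
continuum-physics claim.

Venture `LatticeQCDFlow` (cell pub-lqcd), topic `Exactness`; FANOUT row 7 (`s0-cpn-null`: the
S0-D1 rung — 2D CP⁹, HMC vs THMC with the LO trivializing map, both run with the molecular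
dynamics of Engel–Schaefer §2.2 on the site spheres).  NEW WORK of the cell, composing the tree's
`SphereFrameLift.lean` / `SphereDriftLift.lean` (Liouville in product form: the kick, the flip and
the geodesic drift with ambient momenta preserve `uniformSphere ⊗ Lebesgue`; time reversal of the
ambient drift), row 9's `SplittingIntegrator.lean` (`IsFlipReversible`, palindromes, powers,
`involutive`, `measurePreserving_perm_pow`) and row 7's `MomentumRefresh.lean`
(**`hmc_config_exact`**, **`thmc_config_exact`**: refresh–integrate–accept–forget is exact for ANY
measure-preserving involution) over Mathlib (`GaussianFourier.integral_rexp_neg_mul_sq_norm` for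
the Gaussian normalisation).  Nothing is cited as a fact.  Printed counterpart, NAMED ONLY:
Engel–Schaefer, Comput. Phys. Commun. 182 (2011) 2107, §2 (THMC = HMC in the trivializing-map
variables; CP(N−1) momenta tangent to the site spheres; leapfrog with the exact geodesic update
(9)–(11)); Duane–Kennedy–Pendleton–Roweth 1987.

`SphereGeodesicDrift.lean` proved hypothesis 1 of the HMC skeleton (`involMH`) for the sphere
leapfrog on the tangent bundle and listed hypothesis 2 (Liouville) as NOT CLAIMED;
`MomentumRefresh.thmc_config_exact` was stated for "ANY `vol ⊗ volP`-preserving involution `Φ`".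
This file DISCHARGES `Φ` for the integrator the CP(N−1) code runs, one site sphere at a time, on
the product phase space `S^{d−1} × ℝ^d` with AMBIENT momenta (`d = card m ≥ 2`): the integrator acts
on the tangential momentum `p − ⟪x,p⟫x` by E–S eqs. (10)–(11) and carries the normal component
`⟪x,p⟫` along; for a TANGENT force and the Gaussian kinetic energy `‖p‖²/2 = ‖π‖²/2 + ⟪x,p⟫²/2`
the normal component is INERT — it enters neither the proposed position nor `ΔH`
(`SphereDriftLift.lean`: `inner_ambientKick`, `inner_ambientDrift`, `tangentialPart_ambientDrift`,
`norm_sq_eq_tangential_add_normal`) — so the configuration chain is the E–S chain.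

## Content (`m` finite, `E = EuclideanSpace ℝ m`, `S` its unit sphere)

* `kickPerm`, `flipPerm`, `driftPerm`, **`leapfrogPerm F δ`** (half kick – geodesic drift – half
  kick) as `Equiv.Perm (S × E)`; `kickPerm_isFlipReversible`, `driftPerm_isFlipReversible`,
  `leapfrogPerm_pow_isFlipReversible`, **`involutive_sphereProposal`** (trajectory then flip is an
  involution — for EVERY force field `F`, step size and length).
* **`measurePreserving_leapfrogPerm_pow`**, **`measurePreserving_sphereProposal`** — LIOUVILLE:
  the trajectory and the proposal preserve `uniformSphere ⊗ Lebesgue` (any measurable `F`).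
* **`sphere_hmc_config_exact`** — `hmc_config_exact` INSTANTIATED: refresh `p ∼ Z⁻¹e^{−T}·Lebesgue`,
  run the trajectory, flip, accept with `min(1, e^{−ΔH})`, `H = S(x) + T(p)`, forget `p`:
  `e^{−S}·uniformSphere` is invariant; **`sphere_thmc_config_exact`** — the same through a field
  transformation of the sphere with positive Jacobian, reported through the map (THMC as the
  code runs it); `gaussianWeight_univ_ne_zero_ne_top` and **`sphere_hmc_gaussian_exact`** — the
  Gaussian kinetic energy `T = ‖p‖²/2` (the E–S choice), no normalisation hypothesis left.

NOT CLAIMED: the lattice of many site spheres with site-coupling forces (`SphereLatticeHMCExact.lean`)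
and the U(1) link factors of the CP(N−1) action; irreducibility / ergodicity of the chain; anything
quantitative (acceptance, autocorrelation); `card m = 1`.
-/

noncomputable section

namespace Summit.Ventures.LatticeQCDFlow.Exactness

open MeasureTheory Measure Metric Set Real ProbabilityTheory
open scoped ENNReal InnerProductSpace

/-! ## The sphere leapfrog as permutations of `S × E`; exactness -/

section HMC

variable {m : Type*} [Fintype m] [DecidableEq m]

/-- The kick as a permutation of `S × E` (inverse: the kick with `−δ`). -/
def kickPerm (F : (EuclideanSpace ℝ m) → (EuclideanSpace ℝ m)) (δ : ℝ) : Equiv.Perm ((sphere (0 : EuclideanSpace ℝ m) 1) × (EuclideanSpace ℝ m)) where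
  toFun := ambientKick F δ
  invFun := ambientKick F (-δ)
  left_inv z := by simp [ambientKick]
  right_inv z := by simp [ambientKick]

/-- The flip as a permutation of `S × E`. -/
def flipPerm : Equiv.Perm ((sphere (0 : EuclideanSpace ℝ m) 1) × (EuclideanSpace ℝ m)) where
  toFun := ambientFlip
  invFun := ambientFlip
  left_inv := ambientFlip_ambientFlip
  right_inv := ambientFlip_ambientFlip

omit [DecidableEq m] in
/-- The flip is an involution. -/
theorem flipPerm_mul_flipPerm : (flipPerm : Equiv.Perm ((sphere (0 : EuclideanSpace ℝ m) 1) × (EuclideanSpace ℝ m))) * flipPerm = 1 := by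
  ext z : 1
  exact ambientFlip_ambientFlip z

/-- **The ambient geodesic drift as a permutation** of `S × E`; inverse = flip, drift, flip. -/
def driftPerm (t : ℝ) : Equiv.Perm ((sphere (0 : EuclideanSpace ℝ m) 1) × (EuclideanSpace ℝ m)) where
  toFun := ambientDrift t
  invFun z := ambientFlip (ambientDrift t (ambientFlip z))
  left_inv z := by
    change ambientFlip (ambientDrift t (ambientFlip (ambientDrift t z))) = z
    rw [ambientDrift_flip_ambientDrift, ambientFlip_ambientFlip]
  right_inv z := by
    change ambientDrift t (ambientFlip (ambientDrift t (ambientFlip z))) = z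
    rw [ambientDrift_flip_ambientDrift, ambientFlip_ambientFlip]

omit [DecidableEq m] in
/-- The kick is time-reversible under the flip (no hypothesis on `F`). -/
theorem kickPerm_isFlipReversible (F : (EuclideanSpace ℝ m) → (EuclideanSpace ℝ m)) (δ : ℝ) :
    IsFlipReversible (flipPerm : Equiv.Perm ((sphere (0 : EuclideanSpace ℝ m) 1) × (EuclideanSpace ℝ m))) (kickPerm F δ) := by
  ext z : 1
  change ambientFlip (ambientKick F δ (ambientFlip z)) = ambientKick F (-δ) z
  refine Prod.ext rfl ?_
  simp only [ambientFlip, ambientKick, neg_add, neg_neg, neg_smul]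

omit [DecidableEq m] in
/-- The drift is time-reversible under the flip. -/
theorem driftPerm_isFlipReversible (t : ℝ) :
    IsFlipReversible (flipPerm : Equiv.Perm ((sphere (0 : EuclideanSpace ℝ m) 1) × (EuclideanSpace ℝ m))) (driftPerm t) := by
  ext z : 1
  rfl

/-- **The sphere leapfrog step of E–S §2.2 with ambient momenta**: half kick, geodesic drift, half kick. -/
def leapfrogPerm (F : (EuclideanSpace ℝ m) → (EuclideanSpace ℝ m)) (δ : ℝ) : Equiv.Perm ((sphere (0 : EuclideanSpace ℝ m) 1) × (EuclideanSpace ℝ m)) :=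
  kickPerm F (δ / 2) * driftPerm δ * kickPerm F (δ / 2)

omit [DecidableEq m] in
/-- It is time-reversible, and so is a trajectory of `n` steps. -/
theorem leapfrogPerm_pow_isFlipReversible (F : (EuclideanSpace ℝ m) → (EuclideanSpace ℝ m)) (δ : ℝ) (n : ℕ) :
    IsFlipReversible (flipPerm : Equiv.Perm ((sphere (0 : EuclideanSpace ℝ m) 1) × (EuclideanSpace ℝ m))) (leapfrogPerm F δ ^ n) :=
  ((kickPerm_isFlipReversible F (δ / 2)).palindrome (driftPerm_isFlipReversible δ)
    flipPerm_mul_flipPerm).pow flipPerm_mul_flipPerm n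

omit [DecidableEq m] in
/-- **The HMC proposal on the site sphere — trajectory then flip — is an involution of `S × E`.** -/
theorem involutive_sphereProposal (F : (EuclideanSpace ℝ m) → (EuclideanSpace ℝ m)) (δ : ℝ) (n : ℕ) :
    Function.Involutive ⇑((flipPerm : Equiv.Perm ((sphere (0 : EuclideanSpace ℝ m) 1) × (EuclideanSpace ℝ m))) * leapfrogPerm F δ ^ n) :=
  (leapfrogPerm_pow_isFlipReversible F δ n).involutive

variable [Nonempty m]

/-- **Liouville for the sphere leapfrog**: a trajectory preserves `uniformSphere ⊗ Lebesgue`. -/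
theorem measurePreserving_leapfrogPerm_pow (h2 : 2 ≤ Fintype.card m) {F : (EuclideanSpace ℝ m) → (EuclideanSpace ℝ m)} (hF : Measurable F)
    (δ : ℝ) (n : ℕ) :
    MeasurePreserving ⇑(leapfrogPerm F δ ^ n)
      ((uniformSphere (volume : Measure (EuclideanSpace ℝ m))).prod (volume : Measure (EuclideanSpace ℝ m)))
      ((uniformSphere (volume : Measure (EuclideanSpace ℝ m))).prod (volume : Measure (EuclideanSpace ℝ m))) := by
  refine measurePreserving_perm_pow ?_ n
  rw [leapfrogPerm, Equiv.Perm.coe_mul, Equiv.Perm.coe_mul]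
  have hK := measurePreserving_ambientKick hF (δ / 2) (uniformSphere (volume : Measure (EuclideanSpace ℝ m)))
  have hD := measurePreserving_ambientDrift h2 δ (sphereDefault : (sphere (0 : EuclideanSpace ℝ m) 1))
  exact (hK.comp hD).comp hK

/-- … and so does the proposal "trajectory then flip". -/
theorem measurePreserving_sphereProposal (h2 : 2 ≤ Fintype.card m) {F : (EuclideanSpace ℝ m) → (EuclideanSpace ℝ m)} (hF : Measurable F)
    (δ : ℝ) (n : ℕ) :
    MeasurePreserving ⇑((flipPerm : Equiv.Perm ((sphere (0 : EuclideanSpace ℝ m) 1) × (EuclideanSpace ℝ m))) * leapfrogPerm F δ ^ n)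
      ((uniformSphere (volume : Measure (EuclideanSpace ℝ m))).prod (volume : Measure (EuclideanSpace ℝ m)))
      ((uniformSphere (volume : Measure (EuclideanSpace ℝ m))).prod (volume : Measure (EuclideanSpace ℝ m))) := by
  rw [Equiv.Perm.coe_mul]
  exact (measurePreserving_ambientFlip _).comp (measurePreserving_leapfrogPerm_pow h2 hF δ n)

/-- **HMC ON THE SITE SPHERE IS EXACT** (E–S §2.2 with ambient momenta).  Target `e^{−S}·σ`
(`σ` = uniform probability on `S^{d−1}`, `d ≥ 2`); momenta `p ∈ ℝ^d` refreshed from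
`Z⁻¹ e^{−T}·Lebesgue`; proposal = `n` steps of (half kick by ANY measurable `F`, exact geodesic
drift of the tangential momentum with the normal component carried, half kick) then the momentum
flip; accept with `min(1, e^{−ΔH})`, `H = S + T`; forget the momentum.  The configuration chain
leaves `e^{−S}·σ` invariant — for every step size, trajectory length and force field. -/
theorem sphere_hmc_config_exact (h2 : 2 ≤ Fintype.card m) {S : (sphere (0 : EuclideanSpace ℝ m) 1) → ℝ} (hS : Measurable S)
    {T : (EuclideanSpace ℝ m) → ℝ} (hT : Measurable T) {F : (EuclideanSpace ℝ m) → (EuclideanSpace ℝ m)} (hF : Measurable F) (δ : ℝ) (n : ℕ)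
    (hZ0 : (volume : Measure (EuclideanSpace ℝ m)).withDensity (fun p => ENNReal.ofReal (Real.exp (-T p))) Set.univ ≠ 0)
    (hZtop : (volume : Measure (EuclideanSpace ℝ m)).withDensity (fun p => ENNReal.ofReal (Real.exp (-T p))) Set.univ ≠ ⊤) :
    ProbabilityTheory.Kernel.Invariant
      (refreshUpdate
        (involMH ⇑((flipPerm : Equiv.Perm ((sphere (0 : EuclideanSpace ℝ m) 1) × (EuclideanSpace ℝ m))) * leapfrogPerm F δ ^ n)
          (measurePreserving_sphereProposal h2 hF δ n).measurable fun z : (sphere (0 : EuclideanSpace ℝ m) 1) × (EuclideanSpace ℝ m) => S z.1 + T z.2)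
        (((volume : Measure (EuclideanSpace ℝ m)).withDensity (fun p => ENNReal.ofReal (Real.exp (-T p))) Set.univ)⁻¹ •
          (volume : Measure (EuclideanSpace ℝ m)).withDensity fun p => ENNReal.ofReal (Real.exp (-T p))))
      ((uniformSphere (volume : Measure (EuclideanSpace ℝ m))).withDensity fun x => ENNReal.ofReal (Real.exp (-S x))) :=
  hmc_config_exact hS hT (involutive_sphereProposal F δ n) (measurePreserving_sphereProposal h2 hF δ n)
    hZ0 hZtop

/-- **THMC ON THE SITE SPHERE IS EXACT** (Lüscher's HMC in trivializing-map variables, as run on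
CP(N−1) by Engel–Schaefer): with a field transformation `Φ` of the sphere of positive measurable
Jacobian `J` for `σ`, run the sphere HMC above for the pulled-back action `S∘Φ − log J` and REPORT
`Φ` of the state: `e^{−S}·σ` is invariant. -/
theorem sphere_thmc_config_exact (h2 : 2 ≤ Fintype.card m) {Φ : (sphere (0 : EuclideanSpace ℝ m) 1) ≃ᵐ (sphere (0 : EuclideanSpace ℝ m) 1)} {J : (sphere (0 : EuclideanSpace ℝ m) 1) → ℝ}
    (hJ : ∀ x, 0 < J x) (hJm : Measurable J)
    (hΦ : HasJacobian (uniformSphere (volume : Measure (EuclideanSpace ℝ m))) Φ fun x => ENNReal.ofReal (J x))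
    {S : (sphere (0 : EuclideanSpace ℝ m) 1) → ℝ} (hS : Measurable S) {T : (EuclideanSpace ℝ m) → ℝ} (hT : Measurable T) {F : (EuclideanSpace ℝ m) → (EuclideanSpace ℝ m)} (hF : Measurable F)
    (δ : ℝ) (n : ℕ)
    (hZ0 : (volume : Measure (EuclideanSpace ℝ m)).withDensity (fun p => ENNReal.ofReal (Real.exp (-T p))) Set.univ ≠ 0)
    (hZtop : (volume : Measure (EuclideanSpace ℝ m)).withDensity (fun p => ENNReal.ofReal (Real.exp (-T p))) Set.univ ≠ ⊤) :
    ProbabilityTheory.Kernel.Invariant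
      (conjKernel
        (refreshUpdate
          (involMH ⇑((flipPerm : Equiv.Perm ((sphere (0 : EuclideanSpace ℝ m) 1) × (EuclideanSpace ℝ m))) * leapfrogPerm F δ ^ n)
            (measurePreserving_sphereProposal h2 hF δ n).measurable
            fun z : (sphere (0 : EuclideanSpace ℝ m) 1) × (EuclideanSpace ℝ m) => (S (Φ z.1) - Real.log (J z.1)) + T z.2)
          (((volume : Measure (EuclideanSpace ℝ m)).withDensity (fun p => ENNReal.ofReal (Real.exp (-T p))) Set.univ)⁻¹ •
            (volume : Measure (EuclideanSpace ℝ m)).withDensity fun p => ENNReal.ofReal (Real.exp (-T p))))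
        Φ)
      ((uniformSphere (volume : Measure (EuclideanSpace ℝ m))).withDensity fun x => ENNReal.ofReal (Real.exp (-S x))) :=
  thmc_config_exact hJ hJm hΦ hS hT (involutive_sphereProposal F δ n)
    (measurePreserving_sphereProposal h2 hF δ n) hZ0 hZtop

/-! ### The Gaussian kinetic energy `T = ‖p‖²/2` -/

omit [DecidableEq m] [Nonempty m] in
/-- The Gaussian momentum weight has a finite, non-zero normalisation on `ℝ^d`. -/
theorem gaussianWeight_univ_ne_zero_ne_top :
    (volume : Measure (EuclideanSpace ℝ m)).withDensity (fun p => ENNReal.ofReal (Real.exp (-(‖p‖ ^ 2 / 2)))) Set.univ ≠ 0 ∧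
    (volume : Measure (EuclideanSpace ℝ m)).withDensity (fun p => ENNReal.ofReal (Real.exp (-(‖p‖ ^ 2 / 2)))) Set.univ ≠ ⊤ := by
  have hmeas : Measurable fun p : (EuclideanSpace ℝ m) => ENNReal.ofReal (Real.exp (-(‖p‖ ^ 2 / 2))) :=
    (Real.measurable_exp.comp (measurable_norm.pow_const 2 |>.div_const 2).neg).ennreal_ofReal
  rw [withDensity_apply _ MeasurableSet.univ, Measure.restrict_univ]
  constructor
  · intro h0
    rw [lintegral_eq_zero_iff hmeas] at h0
    have h1 : (volume : Measure (EuclideanSpace ℝ m)) {p | ENNReal.ofReal (Real.exp (-(‖p‖ ^ 2 / 2))) ≠ 0} = 0 := by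
      have := h0
      rw [Filter.EventuallyEq, ae_iff] at this
      simpa using this
    have huniv : {p : (EuclideanSpace ℝ m) | ENNReal.ofReal (Real.exp (-(‖p‖ ^ 2 / 2))) ≠ 0} = Set.univ := by
      refine Set.eq_univ_of_forall fun p => ?_
      rw [Set.mem_setOf_eq, Ne, ENNReal.ofReal_eq_zero, not_le]
      exact Real.exp_pos _
    rw [huniv] at h1
    exact isOpen_univ.measure_ne_zero (volume : Measure (EuclideanSpace ℝ m)) Set.univ_nonempty h1
  · have hint : Integrable (fun p : (EuclideanSpace ℝ m) => Real.exp (-(‖p‖ ^ 2 / 2))) (volume : Measure (EuclideanSpace ℝ m)) := by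
      have h := GaussianFourier.integral_rexp_neg_mul_sq_norm (V := (EuclideanSpace ℝ m)) (b := 1 / 2) (by norm_num)
      have hfun : (fun p : (EuclideanSpace ℝ m) => Real.exp (-(1 / 2) * ‖p‖ ^ 2)) = fun p => Real.exp (-(‖p‖ ^ 2 / 2)) := by
        funext p; congr 1; ring
      rw [hfun] at h
      by_contra hni
      rw [integral_undef hni] at h
      have hpos : 0 < (Real.pi / (1 / 2)) ^ ((Module.finrank ℝ (EuclideanSpace ℝ m) : ℝ) / 2) := by positivity
      exact hpos.ne h
    exact (hint.lintegral_lt_top).ne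

/-- **HMC on the site sphere with Gaussian momenta is exact** (`T = ‖p‖²/2`, the E–S choice; for a
tangent force the normal component of `p` is then inert: `inner_ambientKick`, `inner_ambientDrift`,
`norm_sq_eq_tangential_add_normal`). -/
theorem sphere_hmc_gaussian_exact (h2 : 2 ≤ Fintype.card m) {S : (sphere (0 : EuclideanSpace ℝ m) 1) → ℝ} (hS : Measurable S)
    {F : (EuclideanSpace ℝ m) → (EuclideanSpace ℝ m)} (hF : Measurable F) (δ : ℝ) (n : ℕ) :
    ProbabilityTheory.Kernel.Invariant
      (refreshUpdate
        (involMH ⇑((flipPerm : Equiv.Perm ((sphere (0 : EuclideanSpace ℝ m) 1) × (EuclideanSpace ℝ m))) * leapfrogPerm F δ ^ n)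
          (measurePreserving_sphereProposal h2 hF δ n).measurable
          fun z : (sphere (0 : EuclideanSpace ℝ m) 1) × (EuclideanSpace ℝ m) => S z.1 + ‖z.2‖ ^ 2 / 2)
        (((volume : Measure (EuclideanSpace ℝ m)).withDensity (fun p => ENNReal.ofReal (Real.exp (-(‖p‖ ^ 2 / 2)))) Set.univ)⁻¹ •
          (volume : Measure (EuclideanSpace ℝ m)).withDensity fun p => ENNReal.ofReal (Real.exp (-(‖p‖ ^ 2 / 2)))))
      ((uniformSphere (volume : Measure (EuclideanSpace ℝ m))).withDensity fun x => ENNReal.ofReal (Real.exp (-S x))) :=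
  sphere_hmc_config_exact h2 hS (T := fun p : (EuclideanSpace ℝ m) => ‖p‖ ^ 2 / 2)
    ((measurable_norm.pow_const 2).div_const 2) hF δ n
    gaussianWeight_univ_ne_zero_ne_top.1 gaussianWeight_univ_ne_zero_ne_top.2

end HMC

end Summit.Ventures.LatticeQCDFlow.Exactness

end
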